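import Summits.QuantumFields.BalabanUV.Beta.GAN24.AliasReindex

/-!
# Beta / GAN24 / MonotoneCompose — the fibrewise kernel of Bałaban's COMPOSITION OF AVERAGINGS (1.17): geometric sums factorise across scales,
# `gs z (N·L) = gs z N · gs (N·z) L`, and are `2π`-periodic — the two scalar identities behind node P4-N3 of `HOME/b2b-balaban-gan24-p4/SKELETON-P4.md`
# (`Q_{N·Lc} = Q_N ∘ Q_{Lc}`, `S_{N·Lc}(k′) = S_{Lc}(k′)·S_N(Lc·k′)` on the alias classes) (gan24-p4 gen 2; BINDER-OWNERS row G-an2-4 ∕ (CONV-C); NOT IN PRINT — our proof attempt)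

HONEST FRAMING (page 1 of everything the β sub-cell writes): discharging `BetaPertH` makes Bałaban's UV stability UNCONDITIONAL — a
real constructive-QFT result; it is NOT the continuum limit and NOT the Clay problem.  HONEST DEPENDENCY (cell reorg 2026-08-19, verbatim):
«continuum YM on T⁴ ⇐ BetaPertH ∧ nine spine estimates (0/9 proved); BetaPertH ⇐ (D1) ∧ (D4) ∧ CAP+tail; G-an2-4 gates asym, D1 and NE2/3/4.»
HONEST LABEL: «not in print; our proof attempt»; 0 wall binders instantiated.  ABSOLUTE RULE honoured: [folklore] finite geometric sums over the swarm's
`AliasObjects.gs` (typer row P1-T00); no `def`, no cite, nothing asserted of Bałaban's objects.  The printed composition law is [Balaban1984PropagatorsI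
(1.16)–(1.17)] (tree: `B5Composition116`, position space); this file is its momentum-side scalar kernel, for the N3 leaf of the live swarm's typer.

WHAT IS PROVED.  `gs_zero`; **`gs_mul`**: `gs z (N * L) = gs z N * gs (N·z) L` (a block of `N·L` consecutive phases = `L` blocks of `N`, each shifted by a
multiple of `N·z`); `gs_mul_periodic` (the factorisation with the outer argument read modulo `2π`, via the swarm's `AliasReindex.gs_add_two_pi_mul`);
and the AliasObjects corollaries `sMAl_mul` ∕ `sbMAl_mul` (sub-block weights at scale `M·L` factor through scale `M`).  NOT BetaPertH, NOT continuum, NOT Clay.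
-/

noncomputable section

open Complex Finset
open scoped BigOperators Real
open Literature.Probability.LatticeModels (TorusSite)
open Summit.QuantumFields.BalabanUV.Beta.GAN24.AliasObjects (gs kAl sMAl sbMAl SMAl SbMAl)
open Summit.QuantumFields.BalabanUV.Beta.GAN24.AliasReindex (gs_add_two_pi_mul)

namespace Summit.QuantumFields.BalabanUV.Beta.GAN24.MonotoneCompose

/-! ## §1 Geometric sums across scales -/

/-- `gs z 0 = 0`. [folklore] -/
theorem gs_zero (z : ℂ) : gs z 0 = 0 := by
  simp [gs]

/-- **GEOMETRIC SUMS FACTORISE ACROSS SCALES**: `Σ_{t<N·L} e^{izt} = (Σ_{b<N} e^{izb})·(Σ_{a<L} e^{i(Nz)a})` — a run of `N·L` consecutive phases is `L` consecutive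
runs of `N`, the `a`-th shifted by `e^{i·N z·a}`.  This is the momentum-side kernel of `Q_{N·L} = Q_N ∘ Q_L` (1.17). [folklore] -/
theorem gs_mul (z : ℂ) (N L : ℕ) : gs z (N * L) = gs z N * gs ((N : ℂ) * z) L := by
  induction L with
  | zero => simp [gs_zero]
  | succ L ih =>
      have gs_succ' : gs ((N : ℂ) * z) (L + 1) = gs ((N : ℂ) * z) L + cexp (I * ((N : ℂ) * z) * L) := by
        simp [gs, Finset.sum_range_succ]
      rw [Nat.mul_succ, gs_succ', mul_add, ← ih]
      unfold gs
      rw [Finset.sum_range_add, Finset.sum_mul]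
      congr 1
      refine Finset.sum_congr rfl fun b _ => ?_
      rw [← Complex.exp_add]
      congr 1
      push_cast
      ring

/-- The factorisation with the outer argument read MODULO `2π`: if `N·z = w + 2π·q` (`q : ℤ`) then `gs z (N·L) = gs z N · gs w L` — the form used when the
level-`(j+1)` fine momentum `k′` folds onto the level-`j` alias class (`Lc·k′_{m′} ≡ k_{m′ mod N} mod 2π`). [folklore] -/
theorem gs_mul_periodic (z w : ℂ) (N L : ℕ) (q : ℤ) (h : (N : ℂ) * z = w + 2 * π * q) : gs z (N * L) = gs z N * gs w L := by
  rw [gs_mul, h, gs_add_two_pi_mul]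

/-! ## §2 Sub-block weights at scale `M·L` factor through scale `M` -/

variable {D : ℕ}

/-- `s_{M·L,κ}(m) = s_{M,κ}(m) · gs(M·k_{m,κ}) L`: the directional sub-block weight of `AliasObjects` at scale `M·L` factors through scale `M`. [folklore] -/
theorem sMAl_mul (N M L : ℕ) [NeZero N] (p : Fin D → ℂ) (m : TorusSite D N) (κ : Fin D) :
    sMAl N (M * L) p m κ = sMAl N M p m κ * gs ((M : ℂ) * kAl N p m κ) L := by
  unfold sMAl
  exact gs_mul _ M L

/-- … and the flat twin: `s♭_{M·L,κ}(m) = s♭_{M,κ}(m) · gs(−M·k_{m,κ}) L`. [folklore] -/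
theorem sbMAl_mul (N M L : ℕ) [NeZero N] (p : Fin D → ℂ) (m : TorusSite D N) (κ : Fin D) :
    sbMAl N (M * L) p m κ = sbMAl N M p m κ * gs (-((M : ℂ) * kAl N p m κ)) L := by
  unfold sbMAl
  rw [gs_mul, mul_neg]

/-- … and the box products: `S_{M·L}(m) = S_M(m) · Π_i gs(M·k_{m,i}) L`. [folklore] -/
theorem SMAl_mul (N M L : ℕ) [NeZero N] (p : Fin D → ℂ) (m : TorusSite D N) :
    SMAl N (M * L) p m = SMAl N M p m * ∏ i, gs ((M : ℂ) * kAl N p m i) L := by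
  unfold SMAl
  rw [← Finset.prod_mul_distrib]
  exact Finset.prod_congr rfl fun i _ => sMAl_mul N M L p m i

/-- … flat box product. [folklore] -/
theorem SbMAl_mul (N M L : ℕ) [NeZero N] (p : Fin D → ℂ) (m : TorusSite D N) :
    SbMAl N (M * L) p m = SbMAl N M p m * ∏ i, gs (-((M : ℂ) * kAl N p m i)) L := by
  unfold SbMAl
  rw [← Finset.prod_mul_distrib]
  exact Finset.prod_congr rfl fun i _ => sbMAl_mul N M L p m i

end Summit.QuantumFields.BalabanUV.Beta.GAN24.MonotoneCompose

end
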